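import Summits.BirchSwinnertonDyer.BirchSwinnertonDyer.Theorems.SignedLowerHalvesSmallImageLowerHalfBothSignsRttCharRoadE1KRigidity
import Literature.NumberTheory.EllipticCurves.SelmerTorsionRestriction
import HarnessLib

/-!
# Route `SignedLowerHalves`, crux L `SmallImageLowerHalfBothSigns` (stmt-BirchSwinnertonDyer-23599), line `rtt_w3` v12 — glue brick T-2 (global half),
# THE `k`-STRUCTURE ON THE `K`-SIDE TORSION `W_K[p]` (GLUE memo `Lines/rtt_w3-GLUE-g7.md` §5 (ii): the twist endomorphism
# `û := pBCE ∘ u ∘ pBCE⁻¹` on `T_K[p]`): the stub's frame `e₀ : W[p] ≃ 𝔽_p²` transported along the tree's coefficient isomorphism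
# `torsionBaseChangeEquiv K W p : W[p] ≃+ W_K[p]` is a frame `e₀^K` of `W_K[p] = geomTorsion (W.baseChange K) p` in which `τ ∈ Γ_K` acts by the matrix
# `Φ(ρ̄(res τ))` (∈ `kˣ` by the stub's `hKU`); so the rigidity lemmas of `…RttCharRoadE1KRigidity` (p768610) apply on the `K`-side, where honda's formal
# `𝒪_{K_v}`-module `b ↦ u_b` (p768331, on `W_K[p^∞]`) lives: (i) an additive endomorphism of `W_K[p]` commuting with ONE `τ₀ ∈ Γ_K` whose `ρ̄(res τ₀)` is
# non-scalar has a coordinate matrix in `k` and commutes with ALL of `Γ_K`; (ii) a unital ring action on `W_K[p]` commuting with such a `τ₀` and with one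
# non-scalar member realises every `z ∈ k`; (iii) the transported LEAD endomorphism `û = e_K ∘ u ∘ e_K⁻¹` (`u` with matrix `y`, p767784) has matrix `y`, hence
# ★★ `exists_torsionAction_eq_transport`: `û = u_b|_{W_K[p]}` for some `b` — the W-side content of the TWIST COMPATIBILITY (`ũ := ι_v(b)` then gives
# `s_j (ũ • m) = û (s_j m)` on `M[π]` from the `𝒪_v`-linearity of honda's coordinates `s_j`).

Width seat `bsd-line-slh-p3-w3` g18 under LEAD `cruxlead-stmt-BirchSwinnertonDyer-23599` (cell `bsd-ssimc`; `--supports stmt-BirchSwinnertonDyer-23599 --as helper`).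
THEOREMS ONLY (no definition, no named fact, no instance, no `sorry`); the frame is written inline as `(torsionBaseChangeEquiv L W p).symm.trans e₀`.
BSD / crux L / INJ_top are NOT proved here.

References: [Serre1972] §2.1–2.2; [SerreGaloisCohomology1997] I §2.4, II §1.1 (compatible pairs, base change of coefficients); [DeligneSerre1974] §2.
-/

set_option autoImplicit false
set_option linter.dupNamespace false -- D-0017: single-problem summit, the namespace repeats the problem name by design
noncomputable section

open scoped Classical MatrixGroups

namespace Summit.BirchSwinnertonDyer.BirchSwinnertonDyer.Theorems.SmallImageCharSignedSelmer

open Literature.NumberTheory.GaloisRepresentations Literature.NumberTheory.GaloisRepresentations.Serre1972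
  Literature.NumberTheory.EllipticCurves WeierstrassCurve Matrix

section Transport

variable {F : Type} [Field F] (L : Type) [Field L] [Algebra F L] [Algebra.IsAlgebraic F L]
  (W : WeierstrassCurve F) {p : ℕ} (e₀ : geomTorsion W p ≃+ (Fin 2 → ZMod p))

/-- The inverse coefficient isomorphism intertwines `τ ∈ Γ_L` with `res τ ∈ Γ_F`: `e_L⁻¹ (τ • Q) = (res τ) • e_L⁻¹ Q` (from `torsionBaseChangeEquiv_smul`).
[cite: SerreGaloisCohomology1997, I §2.4] -/
theorem torsionBaseChangeEquiv_symm_smul_absGaloisRestrict (τ : Field.absoluteGaloisGroup L) (Q : geomTorsion (W.baseChange L) p) :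
    (torsionBaseChangeEquiv L W p).symm (τ • Q) = absGaloisRestrict F L τ • (torsionBaseChangeEquiv L W p).symm Q := by
  apply (torsionBaseChangeEquiv L W p).injective
  rw [AddEquiv.apply_symm_apply]
  have h := torsionBaseChangeEquiv_smul L W p τ ((torsionBaseChangeEquiv L W p).symm Q)
  rw [AddEquiv.apply_symm_apply, Subgroup.smul_def, coe_resGalToRange] at h
  exact h.symm

/-- **The transported endomorphism has the same matrix**: if `e₀ (u m) = y *ᵥ e₀ m` on `W[p]` then `û := e_L ∘ u ∘ e_L⁻¹` on `W_L[p]` has matrix `y` in the transported frame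
(the `û := pBCE ∘ u ∘ pBCE⁻¹` of the GLUE memo, on `p`-torsion). [cite: SerreGaloisCohomology1997, I §2.4] -/
theorem coords_transport (u : geomTorsion W p →+ geomTorsion W p) {y : Matrix (Fin 2) (Fin 2) (ZMod p)}
    (hu : ∀ m : geomTorsion W p, e₀ (u m) = y *ᵥ e₀ m) (Q : geomTorsion (W.baseChange L) p) :
    ((torsionBaseChangeEquiv L W p).symm.trans e₀)
        (torsionBaseChangeEquiv L W p (u ((torsionBaseChangeEquiv L W p).symm Q))) =
      y *ᵥ ((torsionBaseChangeEquiv L W p).symm.trans e₀) Q := by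
  rw [AddEquiv.trans_apply, AddEquiv.trans_apply, AddEquiv.symm_apply_apply, hu]

end Transport

section BaseChange

variable {F : Type} [Field F] (L : Type) [Field L] [Algebra F L] [Algebra.IsAlgebraic F L]
  (W : WeierstrassCurve F) {p : ℕ} [Fact p.Prime]
  (Φ : Multiplicative (AddAut (geomTorsion W p)) ≃* GL (Fin 2) (ZMod p))
  (k : Subalgebra (ZMod p) (Matrix (Fin 2) (Fin 2) (ZMod p))) (e₀ : geomTorsion W p ≃+ (Fin 2 → ZMod p))
  (he₀ : ∀ (g : Multiplicative (AddAut (geomTorsion W p))) (x : geomTorsion W p),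
    e₀ (Multiplicative.toAdd g x) = ((Φ g : GL (Fin 2) (ZMod p)) : Matrix (Fin 2) (Fin 2) (ZMod p)) *ᵥ e₀ x)

include he₀ in
/-- ★ **The transported frame is a `Γ_L`-frame**: in `e₀^L := e₀ ∘ e_L⁻¹` the element `τ ∈ Γ_L` acts on `W_L[p]` by the matrix `Φ(ρ̄(res τ))`.
[cite: SerreGaloisCohomology1997, II §1.1] [cite: Serre1972, §2.2] -/
theorem coords_smul_baseChange (τ : Field.absoluteGaloisGroup L) (Q : geomTorsion (W.baseChange L) p) :
    ((torsionBaseChangeEquiv L W p).symm.trans e₀) (τ • Q) =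
      ((Φ (galoisRepTorsion W p (absGaloisRestrict F L τ)) : GL (Fin 2) (ZMod p)) : Matrix (Fin 2) (Fin 2) (ZMod p)) *ᵥ
        ((torsionBaseChangeEquiv L W p).symm.trans e₀) Q := by
  rw [AddEquiv.trans_apply, AddEquiv.trans_apply, torsionBaseChangeEquiv_symm_smul_absGaloisRestrict, coords_smul W Φ e₀ he₀]

include he₀ in
/-- ★ **Commutant rigidity on `W_L[p]`**: an additive endomorphism `û` of `W_L[p]` commuting with ONE `τ₀ ∈ Γ_L` whose `ρ̄(res τ₀) ∈ kˣ` is non-scalar is multiplication by an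
element of `k` in the transported frame. [cite: Serre1972, §2.2] -/
theorem exists_mem_forall_eq_mulVec_of_smul_comm_baseChange {τ₀ : Field.absoluteGaloisGroup L}
    (hτ₀ : Φ (galoisRepTorsion W p (absGaloisRestrict F L τ₀)) ∈ unitGroup k)
    (hτ₀s : ∀ c : ZMod p, ((Φ (galoisRepTorsion W p (absGaloisRestrict F L τ₀)) : GL (Fin 2) (ZMod p)) : Matrix (Fin 2) (Fin 2) (ZMod p)) ≠ c • 1)
    (û : geomTorsion (W.baseChange L) p →+ geomTorsion (W.baseChange L) p) (hcomm : ∀ Q : geomTorsion (W.baseChange L) p, û (τ₀ • Q) = τ₀ • û Q) :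
    ∃ z ∈ k, ∀ Q : geomTorsion (W.baseChange L) p, ((torsionBaseChangeEquiv L W p).symm.trans e₀) (û Q) = z *ᵥ ((torsionBaseChangeEquiv L W p).symm.trans e₀) Q :=
  exists_mem_forall_eq_mulVec_of_comm k _ hτ₀ hτ₀s (fun Q ↦ τ₀ • Q) (coords_smul_baseChange L W Φ e₀ he₀ τ₀) û hcomm

include he₀ in
/-- ★ **Local ⟹ global equivariance on `W_L[p]`**: such a `û` commutes with every `τ ∈ Γ_L` with `ρ̄(res τ) ∈ kˣ` — all of `Γ_L` under the stub's `hKU`.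
[cite: Serre1972, §2.2] -/
theorem smul_comm_of_smul_comm_baseChange (hk : IsField k) {τ₀ : Field.absoluteGaloisGroup L}
    (hτ₀ : Φ (galoisRepTorsion W p (absGaloisRestrict F L τ₀)) ∈ unitGroup k)
    (hτ₀s : ∀ c : ZMod p, ((Φ (galoisRepTorsion W p (absGaloisRestrict F L τ₀)) : GL (Fin 2) (ZMod p)) : Matrix (Fin 2) (Fin 2) (ZMod p)) ≠ c • 1)
    (û : geomTorsion (W.baseChange L) p →+ geomTorsion (W.baseChange L) p) (hcomm : ∀ Q : geomTorsion (W.baseChange L) p, û (τ₀ • Q) = τ₀ • û Q)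
    {τ : Field.absoluteGaloisGroup L} (hτ : Φ (galoisRepTorsion W p (absGaloisRestrict F L τ)) ∈ unitGroup k) (Q : geomTorsion (W.baseChange L) p) :
    û (τ • Q) = τ • û Q :=
  comm_of_comm_of_mem_unitGroup k _ hk hτ₀ hτ₀s (fun Q ↦ τ₀ • Q) (coords_smul_baseChange L W Φ e₀ he₀ τ₀) û hcomm hτ (fun Q ↦ τ • Q)
    (coords_smul_baseChange L W Φ e₀ he₀ τ) Q

include he₀ in
/-- ★★ **A unital ring action on `W_L[p]` commuting with one non-scalar `ρ̄(res τ₀) ∈ kˣ` and having one non-scalar member realises every `z ∈ k`** in the transported frame.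
[cite: Serre1972, §2.1–2.2] -/
theorem forall_mem_exists_torsionAction_eq_baseChange (h2 : Module.finrank (ZMod p) k = 2) {τ₀ : Field.absoluteGaloisGroup L}
    (hτ₀ : Φ (galoisRepTorsion W p (absGaloisRestrict F L τ₀)) ∈ unitGroup k)
    (hτ₀s : ∀ c : ZMod p, ((Φ (galoisRepTorsion W p (absGaloisRestrict F L τ₀)) : GL (Fin 2) (ZMod p)) : Matrix (Fin 2) (Fin 2) (ZMod p)) ≠ c • 1)
    {R : Type*} [Semiring R] (u : R → (geomTorsion (W.baseChange L) p →+ geomTorsion (W.baseChange L) p))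
    (hadd : ∀ (a b : R) (Q : geomTorsion (W.baseChange L) p), u (a + b) Q = u a Q + u b Q)
    (hmul : ∀ (a b : R) (Q : geomTorsion (W.baseChange L) p), u (a * b) Q = u a (u b Q)) (hone : ∀ Q : geomTorsion (W.baseChange L) p, u 1 Q = Q)
    (hcomm : ∀ (r : R) (Q : geomTorsion (W.baseChange L) p), u r (τ₀ • Q) = τ₀ • u r Q)
    {r₀ : R} (hr₀ : ∀ c : ZMod p, ∃ Q : geomTorsion (W.baseChange L) p,
      ((torsionBaseChangeEquiv L W p).symm.trans e₀) (u r₀ Q) ≠ c • ((torsionBaseChangeEquiv L W p).symm.trans e₀) Q)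
    {z : Matrix (Fin 2) (Fin 2) (ZMod p)} (hz : z ∈ k) :
    ∃ r : R, ∀ Q : geomTorsion (W.baseChange L) p,
      ((torsionBaseChangeEquiv L W p).symm.trans e₀) (u r Q) = z *ᵥ ((torsionBaseChangeEquiv L W p).symm.trans e₀) Q :=
  forall_mem_exists_forall_eq_mulVec k _ h2 hτ₀ hτ₀s (fun Q ↦ τ₀ • Q) (coords_smul_baseChange L W Φ e₀ he₀ τ₀) u hadd hmul hone hcomm hr₀ z hz

include he₀ in
/-- ★★ **TWIST, W-side: the transported LEAD endomorphism is a member of any such ring action.** With `u` the `k`-structure endomorphism of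
`exists_kStructure_endomorphism_coords` (`e₀ (u m) = y *ᵥ e₀ m`, `y ∈ k`, p767784) and `uL : R → End(W_L[p])` a unital ring action commuting with one non-scalar
`ρ̄(res τ₀) ∈ kˣ` and having a non-scalar member (honda's `b ↦ u_b` on `p`-torsion, p768331): `∃ b, ∀ Q, uL b Q = e_L (u (e_L⁻¹ Q))` — so on `M[π]` the scalar
`ũ := ι_v(b)` satisfies `s_j (ũ • m) = û (s_j m)` as soon as `s_j` is `𝒪_v`-linear. [cite: Serre1972, §2.2] [cite: SerreGaloisCohomology1997, I §2.4] -/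
theorem exists_torsionAction_eq_transport (h2 : Module.finrank (ZMod p) k = 2) {τ₀ : Field.absoluteGaloisGroup L}
    (hτ₀ : Φ (galoisRepTorsion W p (absGaloisRestrict F L τ₀)) ∈ unitGroup k)
    (hτ₀s : ∀ c : ZMod p, ((Φ (galoisRepTorsion W p (absGaloisRestrict F L τ₀)) : GL (Fin 2) (ZMod p)) : Matrix (Fin 2) (Fin 2) (ZMod p)) ≠ c • 1)
    {R : Type*} [Semiring R] (uL : R → (geomTorsion (W.baseChange L) p →+ geomTorsion (W.baseChange L) p))
    (hadd : ∀ (a b : R) (Q : geomTorsion (W.baseChange L) p), uL (a + b) Q = uL a Q + uL b Q)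
    (hmul : ∀ (a b : R) (Q : geomTorsion (W.baseChange L) p), uL (a * b) Q = uL a (uL b Q)) (hone : ∀ Q : geomTorsion (W.baseChange L) p, uL 1 Q = Q)
    (hcomm : ∀ (r : R) (Q : geomTorsion (W.baseChange L) p), uL r (τ₀ • Q) = τ₀ • uL r Q)
    {r₀ : R} (hr₀ : ∀ c : ZMod p, ∃ Q : geomTorsion (W.baseChange L) p,
      ((torsionBaseChangeEquiv L W p).symm.trans e₀) (uL r₀ Q) ≠ c • ((torsionBaseChangeEquiv L W p).symm.trans e₀) Q)
    (u : geomTorsion W p →+ geomTorsion W p) {y : Matrix (Fin 2) (Fin 2) (ZMod p)} (hy : y ∈ k) (hu : ∀ m : geomTorsion W p, e₀ (u m) = y *ᵥ e₀ m) :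
    ∃ b : R, ∀ Q : geomTorsion (W.baseChange L) p, uL b Q = torsionBaseChangeEquiv L W p (u ((torsionBaseChangeEquiv L W p).symm Q)) := by
  obtain ⟨b, hb⟩ := forall_mem_exists_torsionAction_eq_baseChange L W Φ k e₀ he₀ h2 hτ₀ hτ₀s uL hadd hmul hone hcomm hr₀ hy
  refine ⟨b, fun Q ↦ ((torsionBaseChangeEquiv L W p).symm.trans e₀).injective ?_⟩
  rw [hb, coords_transport L W e₀ u hu]

end BaseChange

end Summit.BirchSwinnertonDyer.BirchSwinnertonDyer.Theorems.SmallImageCharSignedSelmer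

end
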